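/-
Copyright (c) 2026. All rights reserved.
Released under Apache 2.0 license as described in the file LICENSE.
-/
import Literature.AlgebraicGeometry.Pohlmann1968.MultiquadraticCMFieldRankNineCensus
import Literature.NumberTheory.ComplexMultiplication.DegenerateCMTypesElementaryAbelianSignCountDistribution
import HarnessLib

/-!
# The Kubota-rank census of the `65536` CM types on the elementary abelian group of order `32`:
# `32 + 1120 + 3840 + 26880 + 33664` of ranks `2, 5, 9, 11, 17` — the fourth-moment count of the primitive types,
# and the census of the CM types of a multiquadratic CM field of degree `32`

SETTING (tree `CMTypeRankCharacters`, T. Kubota [Kubota1965] §4 Lemma 2 = B. B. Gordon [Gordon1999HodgeAVSurvey]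
Prop. 9.4.1; B. Dodson [Dodson1984] §3.1.1).  `G` a finite commutative group of exponent `2` and order `32` — the
Galois group of a multiquadratic CM field of degree `32` — `ρ ∈ G`, `ρ ≠ 1`, `T ⊆ G` a CM type (`IsCMTypeWith ρ T`,
`|T| = 16`), `a_χ(T) = #{t ∈ T : χ(t) = −1}` the sign count along an odd character `χ` (`Ŝ_T(χ) = Σ_{t∈T} χ(t) =
16 − 2a_χ(T)`), `rank(T) = 1 + #{χ odd : Ŝ_T(χ) ≠ 0}`.  The tree knows: the spectrum `{2, 5, 9, 11, 17}` and the
PROFILE of the sign counts of an even type in each rank (`…ElementaryAbelianOrderThirtyTwo(Stabilizers)`,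
`profile_of_card_thirtytwo`); the censuses `32 / 1120 / 3840` of the ranks `2 / 5 / 9` and `60544` primitive types
(`MultiquadraticCMFieldRankNineCensus`, g41-#1); the parity classes (`32768` odd types, all of rank `17`, and `32768`
even types) and the fourth moment `Σ_{T even} (8 − a_χ(T))⁴ = 1507328` along every odd `χ`
(`DegenerateCMTypesElementaryAbelianSignCountDistribution`, g41-#2).  THIS FILE splits the `60544` primitive types:

> **Theorem** (`sum_odd_fourth_eq_of_even`).  For an EVEN type in order `32` the fourth moment
> `Q(T) = Σ_{χ odd} (8 − a_χ(T))⁴ = (1/16)·Σ_{χ odd} Ŝ_T(χ)⁴` is determined by the rank: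
> `Q = 4096, 1024, 1408, 640, 256` for `rank = 2, 5, 9, 11, 17`.
> **Theorem** (`sum_even_sum_odd_fourth_eq`).  `Σ_{T even} Q(T) = 16·1507328 = 24117248`.
> **Theorem** (THE CENSUS, `census_of_card_eq_thirtyTwo`).  Hence `4096·32 + 1024·1120 + 1408·3840 + 640·n₁₁ +
> 256·b = 24117248` and `32 + 1120 + 3840 + n₁₁ + b = 32768`, so **`n₁₁ = 26880`** types of rank `11`
> (`card_filter_typeRank_eq_eleven_of_card_eq_thirtyTwo`) and **`b = 896` EVEN types of rank `17`**
> (`card_filter_even_typeRank_eq_seventeen_of_card_eq_thirtyTwo` — the graphs of the `896` BENT functions of four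
> variables, N. Tokareva [Tokareva2015BentFunctions] §7.1: «the set `𝓑₄` consists of `896` Boolean functions»), hence
> **`33664 = 32768 + 896` types of rank `17`** (`card_filter_typeRank_eq_seventeen_of_card_eq_thirtyTwo`):
> `65536 = 32 + 1120 + 3840 + 26880 + 33664`.
> **Theorem** (`typeRank_eq_seventeen_iff_forall_of_even`).  An even type of order `32` is nondegenerate iff
> `a_χ(T) ∈ {6, 10}` (i.e. `|Ŝ_T(χ)| = 4`) for EVERY odd `χ` — the bent condition; such types exist
> (`exists_even_typeRank_eq_seventeen_of_card_eq_thirtyTwo`).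

On the field side (§5, multiquadratic CM fields `K` of degree `32`): `K` has exactly `26880` CM types of rank `11` —
by the tree's `isSimple_iff_cmTypeRank_eq_eleven_or_seventeen` / `cmTypeRank_eq_eleven_of_isSimple_of_not_isNondegenerate`
the types of the SIMPLE DEGENERATE abelian `16`-folds (those carrying exceptional Hodge classes, tree
`MultiquadraticCMFieldDegreeThirtyTwoExceptionalClasses`) — and `33664` nondegenerate CM types
(`ncard_isNondegenerate_of_finrank_eq_thirtyTwo`); with the tree's `32 / 1120 / 3840`:
`2^{16} = 32 + 1120 + 3840 + 26880 + 33664` (`census_of_finrank_eq_thirtyTwo`).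

* §0 helpers.
* §1 `sum_odd_fourth_eq_of_even` (the fourth moment by rank), `typeRank_eq_seventeen_iff_forall_of_even` (bent ⟺
  all `a_χ ∈ {6, 10}`).
* §2 `filter_forall_even_eq_filter_even` (the even class through one odd character), `card_filter_forall_even`
  (`32768`), **`sum_even_sum_odd_fourth_eq`** (`24117248`).
* §3 **`card_filter_typeRank_eq_eleven_of_card_eq_thirtyTwo`** (`26880`),
  **`card_filter_even_typeRank_eq_seventeen_of_card_eq_thirtyTwo`** (`896`),
  **`card_filter_typeRank_eq_seventeen_of_card_eq_thirtyTwo`** (`33664`), **`census_of_card_eq_thirtyTwo`**,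
  `exists_even_typeRank_eq_seventeen_of_card_eq_thirtyTwo`, `card_filter_typeRank_ne_of_card_eq_thirtyTwo`
  (`31872` degenerate).
* §4 field: **`ncard_cmTypeRank_eq_eleven_of_finrank_eq_thirtyTwo`** (`26880`),
  **`ncard_cmTypeRank_eq_seventeen_of_finrank_eq_thirtyTwo`** / `ncard_isNondegenerate_of_finrank_eq_thirtyTwo`
  (`33664`), `ncard_not_isNondegenerate_of_finrank_eq_thirtyTwo` (`31872`), **`census_of_finrank_eq_thirtyTwo`**.

HONEST SCOPE.  Elementary moment bookkeeping on the tree's profiles and counts.  The sources print Kubota's formula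
(Kubota, Gordon), Dodson's weight dictionary, the fourth-moment identity `Σ_b W_f(b)⁴ = 2ⁿ𝒱(f)` (C. Carlet
[Carlet2020] §3.1 (3.10)) and the number `896` of bent functions of four variables (Tokareva §7.1, by classification:
all quadratic, `28` classes of `32`); the census `32 / 1120 / 3840 / 26880 / 33664` as a statement about CM types —
equivalently the distribution `1 / 4 / 8 / 10 / 16` of the Walsh-support sizes of the `2^{16}` Boolean functions of
four variables — is obtained here by the moment method, not quoted, and the identification "even nondegenerate
type = graph of a bent function" is the dictionary of the tree's order-`32` file, not formalised as a statement
about Boolean functions.  THEOREMS ONLY: no definition, no named fact, no instance, no `sorry`.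

## References

* [Kubota1965] T. Kubota, *On the field extension by complex multiplication*, Trans. AMS 118 (1965), §4 Lemma 2.
* [Gordon1999HodgeAVSurvey] B. B. Gordon, *A survey of the Hodge conjecture for abelian varieties*, Prop. 9.4.1.
* [Dodson1984] B. Dodson, *The structure of Galois groups of CM-fields*, Trans. AMS 283 (1984), §3.1.1 Theorem.
* [Carlet2020] C. Carlet, *Boolean Functions for Cryptography and Coding Theory*, CUP (2020), §3.1 (3.10), §6.1.
* [Tokareva2015BentFunctions] N. Tokareva, *Bent Functions: Results and Applications to Cryptography*, Academic
  Press (2015), §2.5, §7.1 (`|𝓑₄| = 896`).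
* [Kida2019CountingCMTypes] M. Kida, *Counting formulas for CM-types*, Lemma 2.3, Prop. 3.1.

## Provenance

Lane `lit-hodgefound` (Track 2, Layer A3/A4), seat `lit-hodgefound-p10` generation 41, row g41-#3; neighbours cited
by name, nothing restated: `MultiquadraticCMFieldRankNineCensus` (g41-#1: `census_imprimitive_of_card_eq_thirtyTwo`,
`card_filter_typeRank_eq_nine_of_card_eq_thirtyTwo`, `ncard_…_of_finrank_eq_thirtyTwo`),
`DegenerateCMTypesElementaryAbelianSignCountDistribution` (g41-#2: `SignCount.sum_filter_even_fourth_of_card_eq_thirtyTwo`,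
`SignCount.card_filter_odd_signCount_of_card_eq_thirtyTwo`, `SignCount.even_of_typeRank_ne_of_card_eq_thirtyTwo`,
`SignCount.filter_odd_subset_filter_typeRank_eq_of_card_eq_thirtyTwo`),
`DegenerateCMTypesElementaryAbelianOrderThirtyTwo(Stabilizers)` (`profile_of_card_thirtytwo`,
`typeRank_mem_of_card_thirtytwo`, `two_mul_card_odd_eq`), `DegenerateCMTypesElementaryAbelianTwoGroup`
(`card_filter_mod_two_eq`, `sum_char_eq_zero_iff_two_mul_card_filter_eq`), `CMTypeRankCharactersNumberField`
(`IsCMTypeWith.typeRank_eq_iff_forall_oddCharacters`), `NondegenerateCMTypeDivisorClasses` (`isNondegenerate_iff`),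
`DegenerateCMTypesCyclicCMFieldPrimeSquare` (`CyclicPrimeSquare.ncard_cmType_sep_eq`).
-/

open scoped BigOperators NumberField IsMulCommutative Classical
open NumberField Module

namespace Literature.AlgebraicGeometry.Pohlmann1968

namespace MultiquadraticDegreeThirtyTwoCensus

open Literature.NumberTheory.ComplexMultiplication (typeRank IsCMTypeWith conjGal
  character_apply_eq_one_or_of_mul_self)
open Literature.NumberTheory.ComplexMultiplication.CyclicCMType.ExponentTwo (typeRank_mem_of_card_thirtytwo
  profile_of_card_thirtytwo two_mul_card_odd_eq card_filter_mod_two_eq sum_char_eq_zero_iff_two_mul_card_filter_eq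
  card_filter_typeRank_eq_five_of_card_eq_thirtyTwo)
open Literature.NumberTheory.ComplexMultiplication.CyclicCMType.ExponentTwo.SignCount
  (sum_filter_even_fourth_of_card_eq_thirtyTwo card_filter_odd_signCount_of_card_eq_thirtyTwo
  even_of_typeRank_ne_of_card_eq_thirtyTwo filter_odd_subset_filter_typeRank_eq_of_card_eq_thirtyTwo)
open Literature.AlgebraicGeometry.Pohlmann1968.MultiquadraticRankNineCensus (census_imprimitive_of_card_eq_thirtyTwo
  ncard_cmTypeRank_eq_nine_of_finrank_eq_thirtyTwo)
open Literature.AlgebraicGeometry.Pohlmann1968.MultiquadraticRankTwoCensus (card_filter_typeRank_eq_two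
  ncard_cmTypeRank_eq_two_of_finrank_eq_sixteen ncard_cmTypeRank_eq_two)
open Literature.AlgebraicGeometry.Pohlmann1968.CyclicTwoOddPrimes (isCMTypeWith_galType
  cmTypeRank_eq_typeRank_galType)
open Literature.AlgebraicGeometry.Motives (CMType)

section Group

variable {G : Type*} [CommGroup G] [Fintype G] [DecidableEq G] {ρ : G} {T : Finset G}

/-! ## §0 Helpers -/

section Helpers

omit [Fintype G] [DecidableEq G] in
/-- `g·g = 1` in exponent `2`. [folklore] -/
private theorem mul_self_eq_one_ct (hexp : ∀ g : G, g ^ 2 = 1) (g : G) : g * g = 1 := by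
  rw [← pow_two]; exact hexp g

omit [DecidableEq G] in
/-- `2|T| = |G|` for a CM type. [folklore] -/
private theorem two_mul_card_ct (h : IsCMTypeWith ρ (T : Set G)) : 2 * T.card = Fintype.card G := by
  have hρ2 : ρ * ρ = 1 := by
    have := h.invol (1 : G)
    simpa [smul_eq_mul] using this
  have hmem : ∀ x : G, ρ * x ∈ T ↔ x ∉ T := fun x => by
    have := h.rho_smul_mem_iff x
    simpa only [smul_eq_mul, Finset.mem_coe] using this
  have hinj : Function.Injective fun s : G => ρ * s := fun a b hab => mul_left_cancel hab
  have hc : Tᶜ = T.image fun s => ρ * s := by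
    ext x
    rw [Finset.mem_compl, Finset.mem_image]
    constructor
    · intro hx
      refine ⟨ρ * x, (hmem x).2 hx, ?_⟩
      show ρ * (ρ * x) = x
      rw [← mul_assoc, hρ2, one_mul]
    · rintro ⟨s, hs, rfl⟩
      exact fun hx => ((hmem s).1 hx) hs
  have h1 : Tᶜ.card = T.card := by rw [hc, Finset.card_image_of_injective _ hinj]
  have h2 := Finset.card_add_card_compl T
  omega

omit [DecidableEq G] in
/-- An odd character exists for `ρ ≠ 1`, `ρ² = 1`. [folklore] -/
private theorem exists_odd_ct (hρ1 : ρ ≠ 1) (hρ2 : ρ * ρ = 1) :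
    ∃ χ : AddChar (Additive G) ℂ, χ (Additive.ofMul ρ) = -1 := by
  have hρ0 : (Additive.ofMul ρ : Additive G) ≠ 0 := fun h0 => hρ1 (by simpa using congrArg Additive.toMul h0)
  obtain ⟨χ, hχ⟩ := (AddChar.exists_apply_ne_zero (α := Additive G)).2 hρ0
  exact ⟨χ, (character_apply_eq_one_or_of_mul_self χ hρ2).resolve_left hχ⟩

omit [Fintype G] [DecidableEq G] in
/-- `Σ_{T ∈ S} [rank T = r]·c = c · #{T ∈ S : rank T = r}`. [folklore] -/
private theorem sum_ite_typeRank_eq_ct (S : Finset (Finset G)) (r : ℕ) (c : ℤ) :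
    ∑ T ∈ S, (if typeRank G (T : Set G) = r then c else 0) =
      c * ((S.filter fun T : Finset G => typeRank G (T : Set G) = r).card : ℤ) := by
  rw [← Finset.sum_filter, Finset.sum_const, nsmul_eq_mul, mul_comm]

/-- **The parity class through one odd character** (`8 ∣ |G|`): `a_χ(T)` is even for ALL odd `χ` iff it is even for
one odd `χ₁` (tree `card_filter_mod_two_eq`). [cite: Kubota1965, §4 Lemma 2] [cite: Dodson1984, §3.1.1 Theorem] -/
theorem forall_even_iff_even (hexp : ∀ g : G, g ^ 2 = 1) (h : IsCMTypeWith ρ (T : Set G))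
    (h8 : 8 ∣ Fintype.card G) {χ₁ : AddChar (Additive G) ℂ} (hχ₁ : χ₁ (Additive.ofMul ρ) = -1) :
    (∀ χ : AddChar (Additive G) ℂ, χ (Additive.ofMul ρ) = -1 →
      Even (T.filter fun s => χ (Additive.ofMul s) = -1).card) ↔
      Even (T.filter fun s => χ₁ (Additive.ofMul s) = -1).card := by
  constructor
  · exact fun hall => hall χ₁ hχ₁
  · intro hev χ hχ
    have hmod := card_filter_mod_two_eq hexp h h8 hχ hχ₁
    rw [Nat.even_iff] at hev ⊢
    omega

/-- The finset of EVEN types written through one odd character `χ₁`. [cite: Dodson1984, §3.1.1 Theorem] -/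
theorem filter_forall_even_eq_filter_even (hexp : ∀ g : G, g ^ 2 = 1) (h8 : 8 ∣ Fintype.card G)
    {χ₁ : AddChar (Additive G) ℂ} (hχ₁ : χ₁ (Additive.ofMul ρ) = -1) :
    ((Finset.univ : Finset (Finset G)).filter fun T : Finset G => IsCMTypeWith ρ (T : Set G) ∧
      ∀ χ : AddChar (Additive G) ℂ, χ (Additive.ofMul ρ) = -1 →
        Even (T.filter fun s => χ (Additive.ofMul s) = -1).card) =
    (Finset.univ : Finset (Finset G)).filter fun T : Finset G => IsCMTypeWith ρ (T : Set G) ∧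
      Even (T.filter fun s => χ₁ (Additive.ofMul s) = -1).card :=
  Finset.filter_congr fun _ _ => and_congr_right fun hT => forall_even_iff_even hexp hT h8 hχ₁

end Helpers

/-! ## §1 The fourth moment of an even type is a function of its rank -/

section Moment

/-- The profile system of order `32` (`16n₆₄ + 9n₃₆ + 4n₁₆ + n₄ = 16`, `Σ n = 16`, `rank + n₀ = 17`) determines the
fourth moment `4096n₆₄ + 1296n₃₆ + 256n₁₆ + 16n₄` from the rank. [folklore] -/
private theorem moment_of_profile {r n64 n36 n16 n4 n0 : ℕ} (e1 : 16 * n64 + 9 * n36 + 4 * n16 + n4 = 16)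
    (e2 : n64 + n36 + n16 + n4 + n0 = 16) (e4 : r + n0 = 17)
    (hr : r = 17 ∨ r = 11 ∨ r = 9 ∨ r = 5 ∨ r = 2) :
    (4096 * (n64 : ℤ) + 1296 * (n36 : ℤ) + 256 * (n16 : ℤ) + 16 * (n4 : ℤ) : ℤ) =
      (if r = 2 then 4096 else 0) + (if r = 5 then 1024 else 0) + (if r = 9 then 1408 else 0) +
        (if r = 11 then 640 else 0) + (if r = 17 then 256 else 0) := by
  rcases hr with rfl | rfl | rfl | rfl | rfl
  · have h0 : n0 = 0 := by omega
    have h64 : n64 = 0 := by omega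
    have h36 : n36 = 0 := by omega
    have h16 : n16 = 0 := by omega
    have h4 : n4 = 16 := by omega
    subst h64 h36 h16 h4
    norm_num
  · have h0 : n0 = 6 := by omega
    have h64 : n64 = 0 := by omega
    have h36 : n36 = 0 := by omega
    have h16 : n16 = 2 := by omega
    have h4 : n4 = 8 := by omega
    subst h64 h36 h16 h4
    norm_num
  · have h0 : n0 = 8 := by omega
    have h64 : n64 = 0 := by omega
    have h36 : n36 = 1 := by omega
    have h16 : n16 = 0 := by omega
    have h4 : n4 = 7 := by omega
    subst h64 h36 h16 h4
    norm_num
  · have h0 : n0 = 12 := by omega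
    have h64 : n64 = 0 := by omega
    have h36 : n36 = 0 := by omega
    have h16 : n16 = 4 := by omega
    have h4 : n4 = 0 := by omega
    subst h64 h36 h16 h4
    norm_num
  · have h0 : n0 = 15 := by omega
    have h64 : n64 = 1 := by omega
    have h36 : n36 = 0 := by omega
    have h16 : n16 = 0 := by omega
    have h4 : n4 = 0 := by omega
    subst h64 h36 h16 h4
    norm_num

/-- **THE FOURTH MOMENT BY RANK** (order `32`, even types): `Q(T) = Σ_{χ odd} (8 − a_χ(T))⁴` equals `4096`, `1024`,
`1408`, `640`, `256` for `rank(T) = 2, 5, 9, 11, 17` — from the tree's profiles `(n₆₄, n₃₆, n₁₆, n₄, n₀) =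
(1,0,0,0,15)`, `(0,0,4,0,12)`, `(0,1,0,7,8)`, `(0,0,2,8,6)`, `(0,0,0,16,0)` of the values `(8 − a_χ)² ∈ {64, 36, 16,
4, 0}`. [cite: Kubota1965, §4 Lemma 2] [cite: Dodson1984, §3.1.1 Theorem] [cite: Carlet2020, §3.1 (3.10)] -/
theorem sum_odd_fourth_eq_of_even (hexp : ∀ g : G, g ^ 2 = 1) (h : IsCMTypeWith ρ (T : Set G))
    (h32 : Fintype.card G = 32)
    (hev : ∀ χ : AddChar (Additive G) ℂ, χ (Additive.ofMul ρ) = -1 →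
      Even (T.filter fun s => χ (Additive.ofMul s) = -1).card) :
    ∑ χ ∈ Finset.univ.filter (fun χ : AddChar (Additive G) ℂ => χ (Additive.ofMul ρ) = -1),
        ((8 : ℤ) - ((T.filter fun s => χ (Additive.ofMul s) = -1).card : ℤ)) ^ 4 =
      (if typeRank G (T : Set G) = 2 then 4096 else 0) + (if typeRank G (T : Set G) = 5 then 1024 else 0) +
        (if typeRank G (T : Set G) = 9 then 1408 else 0) + (if typeRank G (T : Set G) = 11 then 640 else 0) +
        (if typeRank G (T : Set G) = 17 then 256 else 0) := by
  obtain ⟨e1, e2, -, e4⟩ := profile_of_card_thirtytwo hexp h h32 hev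
  have hT : T.card = 16 := by have := two_mul_card_ct h; omega
  have hale : ∀ χ : AddChar (Additive G) ℂ, (T.filter fun s => χ (Additive.ofMul s) = -1).card ≤ 16 :=
    fun χ => by rw [← hT]; exact Finset.card_filter_le _ _
  -- pointwise: `(8 − a)^4` through the profile classes
  have hpt : ∀ χ ∈ Finset.univ.filter (fun χ : AddChar (Additive G) ℂ => χ (Additive.ofMul ρ) = -1),
      ((8 : ℤ) - ((T.filter fun s => χ (Additive.ofMul s) = -1).card : ℤ)) ^ 4 =
      4096 * (if (T.filter fun s => χ (Additive.ofMul s) = -1).card = 0 ∨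
          (T.filter fun s => χ (Additive.ofMul s) = -1).card = 16 then 1 else 0) +
      1296 * (if (T.filter fun s => χ (Additive.ofMul s) = -1).card = 2 ∨
          (T.filter fun s => χ (Additive.ofMul s) = -1).card = 14 then 1 else 0) +
      256 * (if (T.filter fun s => χ (Additive.ofMul s) = -1).card = 4 ∨
          (T.filter fun s => χ (Additive.ofMul s) = -1).card = 12 then 1 else 0) +
      16 * (if (T.filter fun s => χ (Additive.ofMul s) = -1).card = 6 ∨
          (T.filter fun s => χ (Additive.ofMul s) = -1).card = 10 then 1 else 0) := by
    intro χ hχ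
    have hle := hale χ
    obtain ⟨b, hb⟩ := hev χ (Finset.mem_filter.1 hχ).2
    have hb8 : b ≤ 8 := by omega
    rw [hb]
    interval_cases b <;> norm_num
  have hsum := Finset.sum_congr rfl hpt
  rw [Finset.sum_add_distrib, Finset.sum_add_distrib, Finset.sum_add_distrib, ← Finset.mul_sum, ← Finset.mul_sum,
    ← Finset.mul_sum, ← Finset.mul_sum, Finset.sum_boole, Finset.sum_boole, Finset.sum_boole, Finset.sum_boole] at hsum
  rw [hsum]
  set n64 := ((Finset.univ.filter fun χ : AddChar (Additive G) ℂ => χ (Additive.ofMul ρ) = -1).filter fun χ =>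
      (T.filter fun s => χ (Additive.ofMul s) = -1).card = 0 ∨
      (T.filter fun s => χ (Additive.ofMul s) = -1).card = 16).card with hn64
  set n36 := ((Finset.univ.filter fun χ : AddChar (Additive G) ℂ => χ (Additive.ofMul ρ) = -1).filter fun χ =>
      (T.filter fun s => χ (Additive.ofMul s) = -1).card = 2 ∨
      (T.filter fun s => χ (Additive.ofMul s) = -1).card = 14).card with hn36
  set n16 := ((Finset.univ.filter fun χ : AddChar (Additive G) ℂ => χ (Additive.ofMul ρ) = -1).filter fun χ =>
      (T.filter fun s => χ (Additive.ofMul s) = -1).card = 4 ∨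
      (T.filter fun s => χ (Additive.ofMul s) = -1).card = 12).card with hn16
  set n4 := ((Finset.univ.filter fun χ : AddChar (Additive G) ℂ => χ (Additive.ofMul ρ) = -1).filter fun χ =>
      (T.filter fun s => χ (Additive.ofMul s) = -1).card = 6 ∨
      (T.filter fun s => χ (Additive.ofMul s) = -1).card = 10).card with hn4
  set n0 := ((Finset.univ.filter fun χ : AddChar (Additive G) ℂ => χ (Additive.ofMul ρ) = -1).filter fun χ =>
      (T.filter fun s => χ (Additive.ofMul s) = -1).card = 8).card with hn0
  -- the moment in the profile counts (the filters of `hsum` and of the profile agree definitionally)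
  change (4096 * (n64 : ℤ) + 1296 * (n36 : ℤ) + 256 * (n16 : ℤ) + 16 * (n4 : ℤ) : ℤ) = _
  clear hsum hpt
  clear_value n64 n36 n16 n4 n0
  exact moment_of_profile e1 e2 e4 (typeRank_mem_of_card_thirtytwo hexp h h32)

/-- **BENT ⟺ ALL `|Ŝ(χ)| = 4`**: an EVEN type of order `32` has full rank `17` iff `a_χ(T) ∈ {6, 10}` for every odd
`χ` (⟹: the rank-`17` profile is `n₄ = 16`; ⟸: no odd character sum `16 − 2a_χ` vanishes, Kubota).
[cite: Kubota1965, §4 Lemma 2] [cite: Dodson1984, §3.1.1 Theorem] [cite: Tokareva2015BentFunctions, §7.1] -/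
theorem typeRank_eq_seventeen_iff_forall_of_even (hexp : ∀ g : G, g ^ 2 = 1) (h : IsCMTypeWith ρ (T : Set G))
    (h32 : Fintype.card G = 32)
    (hev : ∀ χ : AddChar (Additive G) ℂ, χ (Additive.ofMul ρ) = -1 →
      Even (T.filter fun s => χ (Additive.ofMul s) = -1).card) :
    typeRank G (T : Set G) = 17 ↔ ∀ χ : AddChar (Additive G) ℂ, χ (Additive.ofMul ρ) = -1 →
      (T.filter fun s => χ (Additive.ofMul s) = -1).card = 6 ∨ (T.filter fun s => χ (Additive.ofMul s) = -1).card = 10 := by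
  have hT : T.card = 16 := by have := two_mul_card_ct h; omega
  constructor
  · intro hr
    obtain ⟨e1, e2, -, e4⟩ := profile_of_card_thirtytwo hexp h h32 hev
    rw [hr] at e4
    have hO : (Finset.univ.filter fun χ : AddChar (Additive G) ℂ => χ (Additive.ofMul ρ) = -1).card = 16 := by
      have := two_mul_card_odd_eq (T := T) h; rw [h32] at this; omega
    have hn4 : ((Finset.univ.filter fun χ : AddChar (Additive G) ℂ => χ (Additive.ofMul ρ) = -1).filter fun χ =>
        (T.filter fun s => χ (Additive.ofMul s) = -1).card = 6 ∨
        (T.filter fun s => χ (Additive.ofMul s) = -1).card = 10).card = 16 := by omega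
    have hfull := Finset.eq_of_subset_of_card_le
      (Finset.filter_subset (fun χ : AddChar (Additive G) ℂ =>
        (T.filter fun s => χ (Additive.ofMul s) = -1).card = 6 ∨
        (T.filter fun s => χ (Additive.ofMul s) = -1).card = 10)
        (Finset.univ.filter fun χ : AddChar (Additive G) ℂ => χ (Additive.ofMul ρ) = -1)) (by rw [hn4, hO])
    intro χ hχ
    have hmem : χ ∈ (Finset.univ.filter fun χ : AddChar (Additive G) ℂ => χ (Additive.ofMul ρ) = -1) :=
      Finset.mem_filter.2 ⟨Finset.mem_univ _, hχ⟩
    rw [← hfull] at hmem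
    exact (Finset.mem_filter.1 hmem).2
  · intro hall
    have key := h.typeRank_eq_iff_forall_oddCharacters.2 fun χ hχ => by
      rw [Ne, sum_char_eq_zero_iff_two_mul_card_filter_eq hexp χ T, hT]
      rcases hall χ hχ with h6 | h10 <;> omega
    rw [key, h32]

end Moment

/-! ## §2 The even class and its total fourth moment -/

section EvenClass

/-- **ORDER `32`: `32768` EVEN TYPES** (the class being independent of the odd character, g41-#2's count applies).
[cite: Dodson1984, §3.1.1 Theorem] [cite: Kida2019CountingCMTypes, Lemma 2.3] -/
theorem card_filter_forall_even_of_card_eq_thirtyTwo (hexp : ∀ g : G, g ^ 2 = 1) (hρ1 : ρ ≠ 1)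
    (h32 : Fintype.card G = 32) :
    ((Finset.univ : Finset (Finset G)).filter fun T : Finset G => IsCMTypeWith ρ (T : Set G) ∧
      ∀ χ : AddChar (Additive G) ℂ, χ (Additive.ofMul ρ) = -1 →
        Even (T.filter fun s => χ (Additive.ofMul s) = -1).card).card = 32768 := by
  obtain ⟨χ₁, hχ₁⟩ := exists_odd_ct hρ1 (mul_self_eq_one_ct hexp ρ)
  rw [filter_forall_even_eq_filter_even hexp (by rw [h32]; norm_num) hχ₁]
  exact (card_filter_odd_signCount_of_card_eq_thirtyTwo hexp h32 hχ₁).2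

/-- **THE TOTAL FOURTH MOMENT OF THE EVEN CLASS: `Σ_{T even} Σ_{χ odd} (8 − a_χ(T))⁴ = 16·1507328 = 24117248`**
(exchange the sums; along each of the `16` odd characters the even class is the same and g41-#2 gives `1507328`).
[cite: Dodson1984, §3.1.1 Theorem] [cite: Carlet2020, §3.1 (3.10)] -/
theorem sum_even_sum_odd_fourth_eq (hexp : ∀ g : G, g ^ 2 = 1) (hρ1 : ρ ≠ 1) (h32 : Fintype.card G = 32) :
    ∑ T ∈ (Finset.univ : Finset (Finset G)).filter (fun T : Finset G => IsCMTypeWith ρ (T : Set G) ∧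
        ∀ χ : AddChar (Additive G) ℂ, χ (Additive.ofMul ρ) = -1 →
          Even (T.filter fun s => χ (Additive.ofMul s) = -1).card),
      ∑ χ ∈ Finset.univ.filter (fun χ : AddChar (Additive G) ℂ => χ (Additive.ofMul ρ) = -1),
        ((8 : ℤ) - ((T.filter fun s => χ (Additive.ofMul s) = -1).card : ℤ)) ^ 4 = 24117248 := by
  have hρ2 : ρ * ρ = 1 := mul_self_eq_one_ct hexp ρ
  have h8 : 8 ∣ Fintype.card G := by rw [h32]; norm_num
  rw [Finset.sum_comm]
  have inner : ∀ χ ∈ Finset.univ.filter (fun χ : AddChar (Additive G) ℂ => χ (Additive.ofMul ρ) = -1),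
      ∑ T ∈ (Finset.univ : Finset (Finset G)).filter (fun T : Finset G => IsCMTypeWith ρ (T : Set G) ∧
          ∀ χ' : AddChar (Additive G) ℂ, χ' (Additive.ofMul ρ) = -1 →
            Even (T.filter fun s => χ' (Additive.ofMul s) = -1).card),
        ((8 : ℤ) - ((T.filter fun s => χ (Additive.ofMul s) = -1).card : ℤ)) ^ 4 = 1507328 := by
    intro χ hχ
    have hχ' := (Finset.mem_filter.1 hχ).2
    rw [filter_forall_even_eq_filter_even hexp h8 hχ']
    exact sum_filter_even_fourth_of_card_eq_thirtyTwo hexp hρ2 hχ' h32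
  rw [Finset.sum_congr rfl inner, Finset.sum_const, nsmul_eq_mul]
  -- `16` odd characters
  obtain ⟨χ₁, hχ₁⟩ := exists_odd_ct hρ1 hρ2
  have hR := Literature.NumberTheory.ComplexMultiplication.CyclicCMType.ExponentTwo.isCMTypeWith_filter_eq_one
    hexp hρ2 hχ₁
  have hO := two_mul_card_odd_eq hR
  rw [h32] at hO
  have h16 : (Finset.univ.filter fun χ : AddChar (Additive G) ℂ => χ (Additive.ofMul ρ) = -1).card = 16 := by omega
  rw [h16]
  norm_num

end EvenClass

/-! ## §3 The census -/

section Census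

/-- The even types of a rank `r ≠ 17` are all the types of rank `r`. [cite: Kubota1965, §4 Lemma 2]
[cite: Dodson1984, §3.1.1 Theorem] -/
private theorem filter_even_filter_typeRank_eq (hexp : ∀ g : G, g ^ 2 = 1) (h32 : Fintype.card G = 32) {r : ℕ}
    (hr : r ≠ 17) :
    (((Finset.univ : Finset (Finset G)).filter fun T : Finset G => IsCMTypeWith ρ (T : Set G) ∧
      ∀ χ : AddChar (Additive G) ℂ, χ (Additive.ofMul ρ) = -1 →
        Even (T.filter fun s => χ (Additive.ofMul s) = -1).card).filter
      fun T : Finset G => typeRank G (T : Set G) = r) =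
    (Finset.univ : Finset (Finset G)).filter fun T : Finset G =>
      IsCMTypeWith ρ (T : Set G) ∧ typeRank G (T : Set G) = r := by
  rw [Finset.filter_filter]
  refine Finset.filter_congr fun T _ => ?_
  constructor
  · rintro ⟨⟨hT, -⟩, hrk⟩
    exact ⟨hT, hrk⟩
  · rintro ⟨hT, hrk⟩
    exact ⟨⟨hT, fun χ hχ => even_of_typeRank_ne_of_card_eq_thirtyTwo hexp hT h32 hχ (by rw [hrk]; exact hr)⟩, hrk⟩

/-- **THE TWO EQUATIONS**: with `x = #{rank 11}` and `b = #{even, rank 17}`: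
`32 + 1120 + 3840 + x + b = 32768` and `4096·32 + 1024·1120 + 1408·3840 + 640·x + 256·b = 24117248`.
[cite: Kubota1965, §4 Lemma 2] [cite: Dodson1984, §3.1.1 Theorem] [cite: Carlet2020, §3.1 (3.10)] -/
theorem census_equations_of_card_eq_thirtyTwo (hexp : ∀ g : G, g ^ 2 = 1) (hρ1 : ρ ≠ 1)
    (h32 : Fintype.card G = 32) :
    32 + 1120 + 3840 + ((Finset.univ : Finset (Finset G)).filter fun T : Finset G =>
        IsCMTypeWith ρ (T : Set G) ∧ typeRank G (T : Set G) = 11).card +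
      (((Finset.univ : Finset (Finset G)).filter fun T : Finset G => IsCMTypeWith ρ (T : Set G) ∧
        ∀ χ : AddChar (Additive G) ℂ, χ (Additive.ofMul ρ) = -1 →
          Even (T.filter fun s => χ (Additive.ofMul s) = -1).card).filter
        fun T : Finset G => typeRank G (T : Set G) = 17).card = 32768 ∧
    (4096 * 32 + 1024 * 1120 + 1408 * 3840 + 640 * (((Finset.univ : Finset (Finset G)).filter fun T : Finset G =>
        IsCMTypeWith ρ (T : Set G) ∧ typeRank G (T : Set G) = 11).card : ℤ) +
      256 * ((((Finset.univ : Finset (Finset G)).filter fun T : Finset G => IsCMTypeWith ρ (T : Set G) ∧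
        ∀ χ : AddChar (Additive G) ℂ, χ (Additive.ofMul ρ) = -1 →
          Even (T.filter fun s => χ (Additive.ofMul s) = -1).card).filter
        fun T : Finset G => typeRank G (T : Set G) = 17).card : ℤ) = 24117248) := by
  obtain ⟨h2, h5, h9, -, -⟩ := census_imprimitive_of_card_eq_thirtyTwo hexp hρ1 h32
  have hE := card_filter_forall_even_of_card_eq_thirtyTwo hexp hρ1 h32
  have hM := sum_even_sum_odd_fourth_eq hexp hρ1 h32
  -- the moment sum through the rank classes of the even types
  rw [Finset.sum_congr rfl fun T hT => sum_odd_fourth_eq_of_even hexp (Finset.mem_filter.1 hT).2.1 h32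
    (Finset.mem_filter.1 hT).2.2, Finset.sum_add_distrib, Finset.sum_add_distrib, Finset.sum_add_distrib,
    Finset.sum_add_distrib, sum_ite_typeRank_eq_ct, sum_ite_typeRank_eq_ct, sum_ite_typeRank_eq_ct,
    sum_ite_typeRank_eq_ct, sum_ite_typeRank_eq_ct, filter_even_filter_typeRank_eq hexp h32 (by norm_num : (2:ℕ) ≠ 17),
    filter_even_filter_typeRank_eq hexp h32 (by norm_num : (5:ℕ) ≠ 17),
    filter_even_filter_typeRank_eq hexp h32 (by norm_num : (9:ℕ) ≠ 17),
    filter_even_filter_typeRank_eq hexp h32 (by norm_num : (11:ℕ) ≠ 17), h2, h5, h9] at hM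
  -- the count through the rank classes of the even types
  have hcount := Finset.card_eq_sum_ones (((Finset.univ : Finset (Finset G)).filter fun T : Finset G =>
    IsCMTypeWith ρ (T : Set G) ∧ ∀ χ : AddChar (Additive G) ℂ, χ (Additive.ofMul ρ) = -1 →
      Even (T.filter fun s => χ (Additive.ofMul s) = -1).card))
  have hone : ∀ T ∈ ((Finset.univ : Finset (Finset G)).filter fun T : Finset G =>
      IsCMTypeWith ρ (T : Set G) ∧ ∀ χ : AddChar (Additive G) ℂ, χ (Additive.ofMul ρ) = -1 →
        Even (T.filter fun s => χ (Additive.ofMul s) = -1).card),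
      (1 : ℕ) = (if typeRank G (T : Set G) = 2 then 1 else 0) + (if typeRank G (T : Set G) = 5 then 1 else 0) +
        (if typeRank G (T : Set G) = 9 then 1 else 0) + (if typeRank G (T : Set G) = 11 then 1 else 0) +
        (if typeRank G (T : Set G) = 17 then 1 else 0) := by
    intro T hT
    rcases typeRank_mem_of_card_thirtytwo hexp (Finset.mem_filter.1 hT).2.1 h32 with hr | hr | hr | hr | hr <;>
      rw [hr] <;> norm_num
  rw [Finset.sum_congr rfl hone, Finset.sum_add_distrib, Finset.sum_add_distrib, Finset.sum_add_distrib,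
    Finset.sum_add_distrib, Finset.sum_boole, Finset.sum_boole, Finset.sum_boole, Finset.sum_boole, Finset.sum_boole,
    filter_even_filter_typeRank_eq hexp h32 (by norm_num : (2:ℕ) ≠ 17),
    filter_even_filter_typeRank_eq hexp h32 (by norm_num : (5:ℕ) ≠ 17),
    filter_even_filter_typeRank_eq hexp h32 (by norm_num : (9:ℕ) ≠ 17),
    filter_even_filter_typeRank_eq hexp h32 (by norm_num : (11:ℕ) ≠ 17), h2, h5, h9, hE] at hcount
  simp only [Nat.cast_id] at hcount
  refine ⟨by omega, ?_⟩
  linear_combination hM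

/-- **ORDER `32`: EXACTLY `26880` OF THE `65536` CM TYPES HAVE KUBOTA RANK `11`** (the primitive degenerate types;
for Boolean functions of four variables: `26880` have a Walsh support of size `10`). [cite: Kubota1965, §4 Lemma 2]
[cite: Dodson1984, §3.1.1 Theorem] [cite: Carlet2020, §3.1 (3.10)] -/
theorem card_filter_typeRank_eq_eleven_of_card_eq_thirtyTwo (hexp : ∀ g : G, g ^ 2 = 1) (hρ1 : ρ ≠ 1)
    (h32 : Fintype.card G = 32) :
    ((Finset.univ : Finset (Finset G)).filter fun T : Finset G =>
      IsCMTypeWith ρ (T : Set G) ∧ typeRank G (T : Set G) = 11).card = 26880 := by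
  obtain ⟨hc, hm⟩ := census_equations_of_card_eq_thirtyTwo hexp hρ1 h32
  omega

/-- **ORDER `32`: EXACTLY `896` EVEN CM TYPES HAVE RANK `17`** — the graphs of the `896` bent functions of four
variables («the set `𝓑₄` consists of `896` Boolean functions», all quadratic, `28` classes of `32`).
[cite: Tokareva2015BentFunctions, §7.1] [cite: Kubota1965, §4 Lemma 2] [cite: Dodson1984, §3.1.1 Theorem] -/
theorem card_filter_even_typeRank_eq_seventeen_of_card_eq_thirtyTwo (hexp : ∀ g : G, g ^ 2 = 1) (hρ1 : ρ ≠ 1)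
    (h32 : Fintype.card G = 32) :
    ((Finset.univ : Finset (Finset G)).filter fun T : Finset G => IsCMTypeWith ρ (T : Set G) ∧
      (∀ χ : AddChar (Additive G) ℂ, χ (Additive.ofMul ρ) = -1 →
        Even (T.filter fun s => χ (Additive.ofMul s) = -1).card) ∧ typeRank G (T : Set G) = 17).card = 896 := by
  obtain ⟨hc, hm⟩ := census_equations_of_card_eq_thirtyTwo hexp hρ1 h32
  rw [Finset.filter_filter] at hc hm
  have hassoc : ((Finset.univ : Finset (Finset G)).filter fun T : Finset G => IsCMTypeWith ρ (T : Set G) ∧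
      (∀ χ : AddChar (Additive G) ℂ, χ (Additive.ofMul ρ) = -1 →
        Even (T.filter fun s => χ (Additive.ofMul s) = -1).card) ∧ typeRank G (T : Set G) = 17) =
      (Finset.univ : Finset (Finset G)).filter fun T : Finset G => (IsCMTypeWith ρ (T : Set G) ∧
        ∀ χ : AddChar (Additive G) ℂ, χ (Additive.ofMul ρ) = -1 →
          Even (T.filter fun s => χ (Additive.ofMul s) = -1).card) ∧ typeRank G (T : Set G) = 17 :=
    Finset.filter_congr fun _ _ => and_assoc.symm
  rw [hassoc]
  omega

/-- The same count through ONE odd character `χ₁`: `896` types with `a_{χ₁}(T)` even and rank `17`.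
[cite: Tokareva2015BentFunctions, §7.1] [cite: Dodson1984, §3.1.1 Theorem] -/
theorem card_filter_even_typeRank_eq_seventeen_of_card_eq_thirtyTwo' (hexp : ∀ g : G, g ^ 2 = 1)
    (h32 : Fintype.card G = 32) {χ₁ : AddChar (Additive G) ℂ} (hχ₁ : χ₁ (Additive.ofMul ρ) = -1) :
    ((Finset.univ : Finset (Finset G)).filter fun T : Finset G => IsCMTypeWith ρ (T : Set G) ∧
      Even (T.filter fun s => χ₁ (Additive.ofMul s) = -1).card ∧ typeRank G (T : Set G) = 17).card = 896 := by
  have hρ1 : ρ ≠ 1 := by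
    rintro rfl
    rw [ofMul_one, AddChar.map_zero_eq_one] at hχ₁
    norm_num at hχ₁
  rw [← card_filter_even_typeRank_eq_seventeen_of_card_eq_thirtyTwo hexp hρ1 h32]
  congr 1
  refine Finset.filter_congr fun T _ => and_congr_right fun hT => and_congr_left fun _ => ?_
  exact (forall_even_iff_even hexp hT (by rw [h32]; norm_num) hχ₁).symm

/-- **ORDER `32`: EXACTLY `33664 = 32768 + 896` OF THE `65536` CM TYPES ARE NONDEGENERATE (RANK `17`)** — the
`32768` odd types and the `896` bent even types. [cite: Kubota1965, §4 Lemma 2] [cite: Dodson1984, §3.1.1 Theorem]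
[cite: Tokareva2015BentFunctions, §7.1] -/
theorem card_filter_typeRank_eq_seventeen_of_card_eq_thirtyTwo (hexp : ∀ g : G, g ^ 2 = 1) (hρ1 : ρ ≠ 1)
    (h32 : Fintype.card G = 32) :
    ((Finset.univ : Finset (Finset G)).filter fun T : Finset G =>
      IsCMTypeWith ρ (T : Set G) ∧ typeRank G (T : Set G) = 17).card = 33664 := by
  obtain ⟨χ₁, hχ₁⟩ := exists_odd_ct hρ1 (mul_self_eq_one_ct hexp ρ)
  have hsplit := Finset.card_filter_add_card_filter_not
    (s := (Finset.univ : Finset (Finset G)).filter fun T : Finset G =>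
      IsCMTypeWith ρ (T : Set G) ∧ typeRank G (T : Set G) = 17)
    (fun T : Finset G => Even (T.filter fun s => χ₁ (Additive.ofMul s) = -1).card)
  rw [Finset.filter_filter, Finset.filter_filter] at hsplit
  -- even part: `896`
  have heven : ((Finset.univ : Finset (Finset G)).filter fun T : Finset G =>
      (IsCMTypeWith ρ (T : Set G) ∧ typeRank G (T : Set G) = 17) ∧
        Even (T.filter fun s => χ₁ (Additive.ofMul s) = -1).card).card = 896 := by
    rw [← card_filter_even_typeRank_eq_seventeen_of_card_eq_thirtyTwo' hexp h32 hχ₁]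
    congr 1
    exact Finset.filter_congr fun T _ => by tauto
  -- odd part: all `32768` odd types
  have hodd : ((Finset.univ : Finset (Finset G)).filter fun T : Finset G =>
      (IsCMTypeWith ρ (T : Set G) ∧ typeRank G (T : Set G) = 17) ∧
        ¬ Even (T.filter fun s => χ₁ (Additive.ofMul s) = -1).card).card = 32768 := by
    rw [← (card_filter_odd_signCount_of_card_eq_thirtyTwo hexp h32 hχ₁).1]
    congr 1
    refine Finset.filter_congr fun T _ => ?_
    rw [Nat.not_even_iff_odd]
    constructor
    · rintro ⟨⟨hT, -⟩, hodd⟩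
      exact ⟨hT, hodd⟩
    · rintro ⟨hT, hodd⟩
      have hmem := filter_odd_subset_filter_typeRank_eq_of_card_eq_thirtyTwo hexp h32 hχ₁
        (Finset.mem_filter.2 ⟨Finset.mem_univ T, hT, hodd⟩)
      exact ⟨(Finset.mem_filter.1 hmem).2, hodd⟩
  rw [heven, hodd] at hsplit
  omega

/-- **THE COMPLETE KUBOTA-RANK CENSUS OF THE `65536` CM TYPES ON THE ELEMENTARY ABELIAN GROUP OF ORDER `32`**
(w.r.t. any `ρ ≠ 1`): `32` of rank `2`, `1120` of rank `5`, `3840` of rank `9`, `26880` of rank `11`, `33664` of rank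
`17` — `32 + 1120 + 3840 + 26880 + 33664 = 65536`. [cite: Kubota1965, §4 Lemma 2] [cite: Dodson1984, §3.1.1 Theorem]
[cite: Kida2019CountingCMTypes, Lemma 2.3] [cite: Tokareva2015BentFunctions, §7.1] -/
theorem census_of_card_eq_thirtyTwo (hexp : ∀ g : G, g ^ 2 = 1) (hρ1 : ρ ≠ 1) (h32 : Fintype.card G = 32) :
    ((Finset.univ : Finset (Finset G)).filter fun T : Finset G =>
      IsCMTypeWith ρ (T : Set G) ∧ typeRank G (T : Set G) = 2).card = 32 ∧
    ((Finset.univ : Finset (Finset G)).filter fun T : Finset G =>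
      IsCMTypeWith ρ (T : Set G) ∧ typeRank G (T : Set G) = 5).card = 1120 ∧
    ((Finset.univ : Finset (Finset G)).filter fun T : Finset G =>
      IsCMTypeWith ρ (T : Set G) ∧ typeRank G (T : Set G) = 9).card = 3840 ∧
    ((Finset.univ : Finset (Finset G)).filter fun T : Finset G =>
      IsCMTypeWith ρ (T : Set G) ∧ typeRank G (T : Set G) = 11).card = 26880 ∧
    ((Finset.univ : Finset (Finset G)).filter fun T : Finset G =>
      IsCMTypeWith ρ (T : Set G) ∧ typeRank G (T : Set G) = 17).card = 33664 ∧
    ((Finset.univ : Finset (Finset G)).filter fun T : Finset G => IsCMTypeWith ρ (T : Set G)).card = 65536 := by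
  obtain ⟨h2, h5, h9, -, htot⟩ := census_imprimitive_of_card_eq_thirtyTwo hexp hρ1 h32
  exact ⟨h2, h5, h9, card_filter_typeRank_eq_eleven_of_card_eq_thirtyTwo hexp hρ1 h32,
    card_filter_typeRank_eq_seventeen_of_card_eq_thirtyTwo hexp hρ1 h32, htot⟩

/-- **ORDER `32`: `31872 = 32 + 1120 + 3840 + 26880` DEGENERATE CM TYPES** (rank `≠ 17`).
[cite: Kubota1965, §4 Lemma 2] [cite: Dodson1984, §3.1.1 Theorem] -/
theorem card_filter_typeRank_ne_of_card_eq_thirtyTwo (hexp : ∀ g : G, g ^ 2 = 1) (hρ1 : ρ ≠ 1)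
    (h32 : Fintype.card G = 32) :
    ((Finset.univ : Finset (Finset G)).filter fun T : Finset G =>
      IsCMTypeWith ρ (T : Set G) ∧ typeRank G (T : Set G) ≠ 17).card = 31872 := by
  obtain ⟨-, -, -, -, h17, htot⟩ := census_of_card_eq_thirtyTwo hexp hρ1 h32
  have hsplit := Finset.card_filter_add_card_filter_not
    (s := (Finset.univ : Finset (Finset G)).filter fun T : Finset G => IsCMTypeWith ρ (T : Set G))
    (fun T : Finset G => typeRank G (T : Set G) = 17)
  rw [Finset.filter_filter, Finset.filter_filter, h17, htot] at hsplit
  have hsplit' : 33664 + ((Finset.univ : Finset (Finset G)).filter fun T : Finset G =>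
      IsCMTypeWith ρ (T : Set G) ∧ typeRank G (T : Set G) ≠ 17).card = 65536 := hsplit
  omega

/-- **BENT TYPES EXIST IN ORDER `32`**: there is an even CM type of full rank `17` (all `|Ŝ(χ)| = 4`); `896` of them.
[cite: Tokareva2015BentFunctions, §7.1] [cite: Kubota1965, §4 Lemma 2] -/
theorem exists_even_typeRank_eq_seventeen_of_card_eq_thirtyTwo (hexp : ∀ g : G, g ^ 2 = 1) (hρ1 : ρ ≠ 1)
    (h32 : Fintype.card G = 32) :
    ∃ T : Finset G, IsCMTypeWith ρ (T : Set G) ∧ typeRank G (T : Set G) = 17 ∧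
      ∀ χ : AddChar (Additive G) ℂ, χ (Additive.ofMul ρ) = -1 →
        (T.filter fun s => χ (Additive.ofMul s) = -1).card = 6 ∨
          (T.filter fun s => χ (Additive.ofMul s) = -1).card = 10 := by
  have hpos : 0 < ((Finset.univ : Finset (Finset G)).filter fun T : Finset G => IsCMTypeWith ρ (T : Set G) ∧
      (∀ χ : AddChar (Additive G) ℂ, χ (Additive.ofMul ρ) = -1 →
        Even (T.filter fun s => χ (Additive.ofMul s) = -1).card) ∧ typeRank G (T : Set G) = 17).card := by
    rw [card_filter_even_typeRank_eq_seventeen_of_card_eq_thirtyTwo hexp hρ1 h32]; norm_num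
  obtain ⟨T, hT⟩ := Finset.card_pos.1 hpos
  simp only [Finset.mem_filter, Finset.mem_univ, true_and] at hT
  obtain ⟨hT, hev, hr⟩ := hT
  exact ⟨T, hT, hr, (typeRank_eq_seventeen_iff_forall_of_even hexp hT h32 hev).1 hr⟩

end Census

end Group

/-! ## §4 Multiquadratic CM fields of degree `32` -/

section Field

variable {K : Type} [Field K] [NumberField K] [IsCMField K] [IsGalois ℚ K]

/-- Transport of a count from the Galois group (tree `CyclicPrimeSquare.ncard_cmType_sep_eq`), for any predicate on
the rank. [cite: Shimura1998, §8.1 and §18.2 Lemma (i)] -/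
private theorem ncard_cmTypeRank_eq_card_filter_ct (hexp : ∀ g : K ≃ₐ[ℚ] K, g ^ 2 = 1) (φ₀ : K →+* ℂ)
    (P : ℕ → Prop) :
    {Φ : CMType K | P (cmTypeRank Φ)}.ncard =
      ((Finset.univ : Finset (Finset (K ≃ₐ[ℚ] K))).filter fun T : Finset (K ≃ₐ[ℚ] K) =>
        IsCMTypeWith (conjGal : K ≃ₐ[ℚ] K) (T : Set (K ≃ₐ[ℚ] K)) ∧
          P (typeRank (K ≃ₐ[ℚ] K) (T : Set (K ≃ₐ[ℚ] K)))).card := by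
  haveI := Multiquadratic.isAbelianGalois_of_forall_sq_eq_one hexp
  have hρ := AbelianCMFieldExistence.apply_conjGal_eq (K := K) φ₀
  rw [CyclicPrimeSquare.ncard_cmType_sep_eq hρ (fun Φ : CMType K => P (cmTypeRank Φ))
    (fun T : Finset (K ≃ₐ[ℚ] K) => P (typeRank (K ≃ₐ[ℚ] K) (T : Set (K ≃ₐ[ℚ] K))))
    (fun Φ => by rw [cmTypeRank_eq_typeRank_galType Φ φ₀])]
  have hset : {ΦG : Finset (K ≃ₐ[ℚ] K) | IsCMTypeWith (conjGal : K ≃ₐ[ℚ] K) (ΦG : Set (K ≃ₐ[ℚ] K)) ∧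
      P (typeRank (K ≃ₐ[ℚ] K) (ΦG : Set (K ≃ₐ[ℚ] K)))} =
      ↑((Finset.univ : Finset (Finset (K ≃ₐ[ℚ] K))).filter fun T : Finset (K ≃ₐ[ℚ] K) =>
        IsCMTypeWith (conjGal : K ≃ₐ[ℚ] K) (T : Set (K ≃ₐ[ℚ] K)) ∧
          P (typeRank (K ≃ₐ[ℚ] K) (T : Set (K ≃ₐ[ℚ] K)))) := by
    ext T; simp
  rw [hset, Set.ncard_coe_finset]

/-- **A MULTIQUADRATIC CM FIELD OF DEGREE `32` HAS EXACTLY `26880` CM TYPES OF RANK `11`** — the types of the simple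
abelian `16`-folds with complex multiplication by `K` that carry exceptional Hodge classes (tree
`cmTypeRank_eq_eleven_of_isSimple_of_not_isNondegenerate`, `MultiquadraticCMFieldDegreeThirtyTwoExceptionalClasses`).
[cite: Kubota1965, §4 Lemma 2] [cite: Dodson1984, §3.1.1 Theorem] [cite: Carlet2020, §3.1 (3.10)] -/
theorem ncard_cmTypeRank_eq_eleven_of_finrank_eq_thirtyTwo (hexp : ∀ g : K ≃ₐ[ℚ] K, g ^ 2 = 1) (φ₀ : K →+* ℂ)
    (hK : finrank ℚ K = 32) : {Φ : CMType K | cmTypeRank Φ = 11}.ncard = 26880 := by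
  haveI := Multiquadratic.isAbelianGalois_of_forall_sq_eq_one hexp
  have hρ := AbelianCMFieldExistence.apply_conjGal_eq (K := K) φ₀
  rw [ncard_cmTypeRank_eq_card_filter_ct hexp φ₀ (fun r => r = 11)]
  convert card_filter_typeRank_eq_eleven_of_card_eq_thirtyTwo hexp (conjGalElt_ne_one hρ)
    (by rw [card_gal_eq_finrank φ₀, hK]) using 3

/-- **A MULTIQUADRATIC CM FIELD OF DEGREE `32` HAS EXACTLY `33664` CM TYPES OF RANK `17`.** [cite: Kubota1965, §4 Lemma 2]
[cite: Dodson1984, §3.1.1 Theorem] [cite: Tokareva2015BentFunctions, §7.1] -/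
theorem ncard_cmTypeRank_eq_seventeen_of_finrank_eq_thirtyTwo (hexp : ∀ g : K ≃ₐ[ℚ] K, g ^ 2 = 1) (φ₀ : K →+* ℂ)
    (hK : finrank ℚ K = 32) : {Φ : CMType K | cmTypeRank Φ = 17}.ncard = 33664 := by
  haveI := Multiquadratic.isAbelianGalois_of_forall_sq_eq_one hexp
  have hρ := AbelianCMFieldExistence.apply_conjGal_eq (K := K) φ₀
  rw [ncard_cmTypeRank_eq_card_filter_ct hexp φ₀ (fun r => r = 17)]
  convert card_filter_typeRank_eq_seventeen_of_card_eq_thirtyTwo hexp (conjGalElt_ne_one hρ)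
    (by rw [card_gal_eq_finrank φ₀, hK]) using 3

/-- **`33664` OF THE `65536` CM TYPES OF A MULTIQUADRATIC CM FIELD OF DEGREE `32` ARE NONDEGENERATE** (`51.4 %`).
[cite: Kubota1965, §4 Lemma 2] [cite: Dodson1984, §3.1.1 Theorem] [cite: Tokareva2015BentFunctions, §7.1] -/
theorem ncard_isNondegenerate_of_finrank_eq_thirtyTwo (hexp : ∀ g : K ≃ₐ[ℚ] K, g ^ 2 = 1) (φ₀ : K →+* ℂ)
    (hK : finrank ℚ K = 32) : {Φ : CMType K | IsNondegenerate Φ}.ncard = 33664 := by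
  rw [← ncard_cmTypeRank_eq_seventeen_of_finrank_eq_thirtyTwo hexp φ₀ hK]
  congr 1
  ext Φ
  simp only [Set.mem_setOf_eq]
  rw [_root_.Literature.AlgebraicGeometry.Pohlmann1968.isNondegenerate_iff, hK]

/-- **`31872` CM types of a multiquadratic CM field of degree `32` are DEGENERATE** (their abelian varieties carry
exceptional Hodge classes on some power). [cite: Kubota1965, §4 Lemma 2] [cite: Dodson1984, §3.1.1 Theorem] -/
theorem ncard_not_isNondegenerate_of_finrank_eq_thirtyTwo (hexp : ∀ g : K ≃ₐ[ℚ] K, g ^ 2 = 1) (φ₀ : K →+* ℂ)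
    (hK : finrank ℚ K = 32) : {Φ : CMType K | ¬ IsNondegenerate Φ}.ncard = 31872 := by
  haveI := Multiquadratic.isAbelianGalois_of_forall_sq_eq_one hexp
  have hρ := AbelianCMFieldExistence.apply_conjGal_eq (K := K) φ₀
  have h := ncard_cmTypeRank_eq_card_filter_ct hexp φ₀ (fun r => r ≠ 17)
  have hset : {Φ : CMType K | ¬ IsNondegenerate Φ} = {Φ : CMType K | cmTypeRank Φ ≠ 17} := by
    ext Φ
    simp only [Set.mem_setOf_eq]
    rw [_root_.Literature.AlgebraicGeometry.Pohlmann1968.isNondegenerate_iff, hK]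
  rw [hset, h]
  convert card_filter_typeRank_ne_of_card_eq_thirtyTwo hexp (conjGalElt_ne_one hρ)
    (by rw [card_gal_eq_finrank φ₀, hK]) using 3

/-- **THE RANK CENSUS OF A MULTIQUADRATIC CM FIELD OF DEGREE `32`**: of its `65536` CM types, `32` have rank `2`,
`1120` rank `5`, `3840` rank `9`, `26880` rank `11` and `33664` rank `17` (nondegenerate).
[cite: Kubota1965, §4 Lemma 2] [cite: Kida2019CountingCMTypes, Lemma 2.3] [cite: Dodson1984, §3.1.1 Theorem]
[cite: Tokareva2015BentFunctions, §7.1] -/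
theorem census_of_finrank_eq_thirtyTwo (hexp : ∀ g : K ≃ₐ[ℚ] K, g ^ 2 = 1) (φ₀ : K →+* ℂ)
    (hK : finrank ℚ K = 32) :
    Nat.card (CMType K) = 65536 ∧ {Φ : CMType K | cmTypeRank Φ = 2}.ncard = 32 ∧
      {Φ : CMType K | cmTypeRank Φ = 5}.ncard = 1120 ∧ {Φ : CMType K | cmTypeRank Φ = 9}.ncard = 3840 ∧
      {Φ : CMType K | cmTypeRank Φ = 11}.ncard = 26880 ∧ {Φ : CMType K | cmTypeRank Φ = 17}.ncard = 33664 := by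
  have htot : Nat.card (CMType K) = 65536 := by
    rw [Literature.NumberTheory.ComplexMultiplication.CMTypeCount.natCard_cmType, hK]; norm_num
  have h2 := ncard_cmTypeRank_eq_two hexp φ₀ (K := K)
  rw [hK] at h2
  exact ⟨htot, h2, ncard_cmTypeRank_eq_five_of_finrank_eq_thirtyTwo hexp φ₀ hK,
    ncard_cmTypeRank_eq_nine_of_finrank_eq_thirtyTwo hexp φ₀ hK,
    ncard_cmTypeRank_eq_eleven_of_finrank_eq_thirtyTwo hexp φ₀ hK,
    ncard_cmTypeRank_eq_seventeen_of_finrank_eq_thirtyTwo hexp φ₀ hK⟩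

end Field

end MultiquadraticDegreeThirtyTwoCensus

end Literature.AlgebraicGeometry.Pohlmann1968
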